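import Summits.BirchSwinnertonDyer.BirchSwinnertonDyer.Theorems.PrintCf2RamifiedOffTYZQFormIdentitySix
import Summits.BirchSwinnertonDyer.BirchSwinnertonDyer.Theorems.PrintCf2RamifiedOffTYZQFormIdentitySeven
import HarnessLib

/-!
# Route `PrintCf2`, crux stmt-BirchSwinnertonDyer-20509 `RamifiedOffTYZOfFacts` — **THE DUAL COFACTOR IDENTITY (★)₆′ FOR MONSKY'S EVEN MATRIX**
# (cell `bsd-print-cf2`, LEAD of 20509 g14, line `offtyz-v7`, cycle 15; kernel helpers `--supports stmt-BirchSwinnertonDyer-20509`)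

Step (P1) of the successor programme of the crux workfile `Cruxes/RamifiedOffTYZOfFacts/Lines/offtyz_v7_RegimeFreeLaw.md` §8.7 (LEAD g13 found
(★)₆′ and verified it on 12368 instances) and §3 of `Lines/offtyz_v7_EvenOmegaProof.md` (LEAD g14: the three-line forest proof).  For distinct
odd primes `p₁, …, p_k` (NO residue hypothesis on `∏ pᵢ` is needed), Monsky's even matrix `M = [[Aᵀ + D₂, D₋₁],[D₂, A + D₂]]`
(`HeathBrown1994.monskyMatrixEven`), `a i j = A i j`, `y = ((−1/pᵢ)₊)`, `z = ((2/pᵢ)₊)`: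

  **(★)₆′**  `adj(M)_{(inr j)(inl j)} = Σ_{S ∋ j} det(A_S + D₂(S)) · det M_{d_{Sᶜ}}`   (ALL `S ∋ j`; `det M_{d_{Sᶜ}} = QForm.coblockWeight p S`, Monsky's
  ODD matrix of the co-block — of either parity; `A_S + D₂(S) = lap a S z`).

* §1 `adjugate_bigN_mark_inl_inl_eq_sum_dual` (ABSTRACT, no hypothesis at all): for the doubled matrix `N = bigN a D y z z`,
  `adj(N)_{(inl j)(inl j)} = Σ_{S₀ ⊆ D∖j} det(lap a S z) · det(bigN a (D∖S) y z 0)`, `S = {j} ∪ S₀` — the tree's pointed forest sum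
  (`adjugate_bigN_inl_inl`: `Σ_B q_z(B)·setExp(fwt a y z z)(D∖B)`) regrouped: `det(lap a S z) = setExp(q_z)(S)` (matrix-forest theorem), peel the
  block of `j`, and `setExp(q_z) ⋆ setExp(fwt a y z 0) = setExp(fwt a y z z)` (`q_z + (Σy)q_z = (1 + Σy)q_z`, root absorption).
* §2 THE UNIFORM DICTIONARY `det M_{d_T} = det bigN a T y z 0` for EVERY sub-block `T`, both parities (`coblockWeight_eq_det_bigN_zero_root`): for
  `Σ_T y = 1` the tree's `coblockWeight_eq_det_bigN_zero` (transposed weights) plus `det bigN aᵀ T y z 0 = det bigN a T y z 0` (odd blocks are flat: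
  `κ_c^{aᵀ}(B) = κ_c^{a}(B)`, §2a); for `Σ_T y = 0` the tree's `det_bigN_self_eq_coblockWeight` (`det bigN a T z z z`) plus
  `det bigN a T y z 0 = det bigN a T z z z` (§2b: root absorption, marks into roots, pointing, parity).
* §3 (★)₆′ for Monsky's matrix (`adjugate_monskyMatrixEven_inr_inl_eq_sum`, `…_eq_sum_filter`): the column swap
  `adj(M)_{(inr j)(inl j)} = adj(bigN a univ y z z)_{(inl j)(inl j)}` + §1 + §2; and the census coordinates
  `det(lap a S z) = det(blockLegendreMatrix p S + legendreDiagonal (blockPrimes p S) 2)` (`det_lap_eq_det_block_two`).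
USE: row (ii) of the even Ω-identity `EvenOmegaMatrixIdentity` (`Σ_S w_S κ^S_∞ = Σ_j t_j (A_j + A′_j)`) follows from (★)₆ + (★)₆′ by determinant
algebra (g13 §8.7); rows (iii)/(iv) by `Lines/offtyz_v7_EvenOmegaProof.md` §5–§6.  Pure linear algebra over `𝔽₂` + quadratic reciprocity; no `sorry`.
BSD is not proved by any of this; no class is closed.

References: [cite: Chaiken1982, §2 (all minors matrix tree theorem)]; [cite: HeathBrown1994SelmerCongruentII, Appendix (Monsky), typescript p. 39 L10 – p. 41 L36];
[cite: Stanley1999EC2, Cor. 5.1.6]; [cite: HornJohnson2013, §0.8.2]; crux notes `Lines/offtyz_v7_RegimeFreeLaw.md` §8.7, `Lines/offtyz_v7_EvenOmegaProof.md` §3.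
-/

namespace Summit.BirchSwinnertonDyer.PrintCf2.QFormForest

open Matrix Finset Literature.LinearAlgebra.Matrix Literature.Combinatorics.Enumerative
open Literature.NumberTheory.EllipticCurves.Smith2016

variable {V : Type*} [Fintype V] [LinearOrder V]

/-! ## §1. The dual cofactor identity, abstract form (no hypothesis) -/

/-- `fwt a y z (0 + z) = fwt a y z z` (root weights written as a shift of `0`). [cite: Chaiken1982, §2] -/
theorem fwt_zero_add_root (a : V → V → ZMod 2) (y z : V → ZMod 2) :
    fwt a y z (fun i => (0 : V → ZMod 2) i + z i) = fwt a y z z := by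
  congr 1
  funext i
  rw [Pi.zero_apply, zero_add]

/-- **THE DUAL COFACTOR IDENTITY, ABSTRACT FORM.**  For every doubled matrix `N = bigN a D y z z` (marks `y`, roots `z`, root weights `z`) and
`j ∈ D`: `adj(N)_{(inl j)(inl j)} = Σ_{S₀ ⊆ D∖j} det(lap a S z) · det(bigN a (D∖S) y z 0)`, `S = {j} ∪ S₀`.  Proof: the mark-copy cofactor is
the pointed forest sum `Σ_{B∋j} q_z(B) setExp(fwt a y z z)(D∖B)` (tree); on the right `det(lap a S z) = setExp(q_z)(S)`, peel the block
`B ∋ j`, and convolve `setExp(q_z) ⋆ setExp(fwt a y z 0) = setExp(fwt a y z (0 + z))` (root absorption).  No reciprocity and no parity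
hypothesis is used. [cite: Chaiken1982, §2 (all minors matrix tree theorem)] [cite: Stanley1999EC2, Cor. 5.1.6 (exponential formula)] -/
theorem adjugate_bigN_mark_inl_inl_eq_sum_dual (a : V → V → ZMod 2) (y z : V → ZMod 2) {D : Finset V} {j : V} (hj : j ∈ D) :
    (bigN a D y z z).adjugate (Sum.inl j) (Sum.inl j) =
      ∑ S₀ ∈ (D.erase j).powerset, (lap a (insert j S₀) z).det * (bigN a (D.erase j \ S₀) y z 0).det := by
  classical
  rw [adjugate_bigN_inl_inl a hj y z z]
  -- right side: forest forms and the peel of the block of `j`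
  have hstep : ∀ S₀ ∈ (D.erase j).powerset, (lap a (insert j S₀) z).det * (bigN a (D.erase j \ S₀) y z 0).det =
      ∑ B₀ ∈ S₀.powerset, qwt a z (insert j B₀) * setExp (qwt a z) (S₀ \ B₀) * setExp (fwt a y z 0) (D.erase j \ S₀) := by
    intro S₀ hS₀
    rw [mem_powerset] at hS₀
    have hjS₀ : j ∉ S₀ := fun h => notMem_erase j D (hS₀ h)
    rw [det_lap_eq_setExp, det_bigN_eq_setExp, setExp_insert _ hjS₀, sum_mul]
  rw [sum_congr rfl hstep, sum_powerset_sum_powerset_sub]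
  refine sum_congr rfl fun B₀ hB₀ => ?_
  -- regroup the complement `E = S₀ ∖ B₀` and absorb the `q_z`-roots
  have hE : ∀ E ∈ ((D.erase j) \ B₀).powerset,
      qwt a z (insert j B₀) * setExp (qwt a z) ((B₀ ∪ E) \ B₀) * setExp (fwt a y z 0) (D.erase j \ (B₀ ∪ E)) =
        qwt a z (insert j B₀) * (setExp (qwt a z) E * setExp (fwt a y z 0) (((D.erase j) \ B₀) \ E)) := by
    intro E hE
    rw [mem_powerset] at hE
    obtain ⟨h1, h2⟩ := union_sdiff_bookkeeping hE
    rw [h1, h2, mul_assoc]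
  rw [sum_congr rfl hE, ← mul_sum, ← setExp_fwt_add_root, fwt_zero_add_root]

/-! ## §2a. Odd blocks: transposing the weights costs nothing -/

/-- **On an odd block the converging and diverging arborescence counts agree**: under the reciprocity law on `B` with `Σ_B y = 1`, for
`c ∈ B`, `treeDet aᵀ B c = treeDet a B c` — the reduced Laplacian of the transposed weights is the transpose of the reduced Laplacian
(row and column sums of `a` inside `B` differ by `y_i (Σ_B y + y_i) = 0`).
[cite: HeathBrown1994SelmerCongruentII, Appendix (Monsky), typescript p. 39 L34–L41 (row versus column sums of A under (31))] [cite: ChebotarevAgaev2002, §3 Thm. 1] -/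
theorem treeDet_transpose_of_odd (a : V → V → ZMod 2) (y : V → ZMod 2) {B : Finset V}
    (hrec : ∀ i ∈ B, ∀ j ∈ B, i ≠ j → a i j + a j i = y i * y j) (hodd : ∑ i ∈ B, y i = 1) {c : V} (hc : c ∈ B) :
    treeDet (fun i j => a j i) B c = treeDet a B c := by
  -- column sum into `i` = row sum out of `i` inside `B`
  have hdiag : ∀ i ∈ B, ∑ k ∈ B.erase i, a k i = ∑ k ∈ B.erase i, a i k := by
    intro i hi
    have hpair : ∀ k ∈ B.erase i, a k i = a i k + y i * y k := by
      intro k hk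
      have h := hrec i hi k (mem_of_mem_erase hk) (ne_of_mem_erase hk).symm
      have e : ∀ u v w : ZMod 2, u + v = w → v = u + w := by decide
      exact e _ _ _ h
    rw [sum_congr rfl hpair, sum_add_distrib, ← mul_sum]
    have hrest : ∑ k ∈ B.erase i, y k = 1 + y i := by
      have h := add_sum_erase B y hi
      rw [hodd] at h
      have e : ∀ u v : ZMod 2, u + v = 1 → v = 1 + u := by decide
      exact e _ _ h
    rw [hrest]
    have e : ∀ u s : ZMod 2, s + u * (1 + u) = s := by decide
    exact e _ _
  have hmat : lap (fun i j => a j i) (B.erase c) (fun i => a c i) = (lap a (B.erase c) (fun i => a i c))ᵀ := by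
    ext i j
    rw [transpose_apply, lap_apply, lap_apply]
    by_cases hij : i ∈ B.erase c ∧ j ∈ B.erase c
    · have hji : j ∈ B.erase c ∧ i ∈ B.erase c := ⟨hij.2, hij.1⟩
      rw [if_pos hij, if_pos hji]
      by_cases he : i = j
      · subst he
        rw [if_pos rfl, if_pos rfl]
        have hi : i ∈ B := mem_of_mem_erase hij.1
        have hci : c ≠ i := (ne_of_mem_erase hij.1).symm
        -- `a c i + Σ_{B∖c∖i} a k i = Σ_{B∖i} a k i` and likewise for rows
        have hcol : a c i + ∑ k ∈ (B.erase c).erase i, a k i = ∑ k ∈ B.erase i, a k i := by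
          rw [erase_right_comm]
          exact add_sum_erase (B.erase i) (fun k => a k i) (mem_erase.mpr ⟨hci, hc⟩)
        have hrow : a i c + ∑ k ∈ (B.erase c).erase i, a i k = ∑ k ∈ B.erase i, a i k := by
          rw [erase_right_comm]
          exact add_sum_erase (B.erase i) (fun k => a i k) (mem_erase.mpr ⟨hci, hc⟩)
        rw [hcol, hrow, hdiag i hi]
      · rw [if_neg he, if_neg (Ne.symm he)]
    · have hji : ¬ (j ∈ B.erase c ∧ i ∈ B.erase c) := fun h => hij ⟨h.2, h.1⟩
      rw [if_neg hij, if_neg hji]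
      by_cases he : i = j
      · subst he; rfl
      · rw [if_neg he, if_neg (Ne.symm he)]
  rw [treeDet, treeDet, hmat, det_transpose]

/-- **`det bigN aᵀ T y z 0 = det bigN a T y z 0` on an odd block** (`Σ_T y = 1`, reciprocity): in the forest formula every block `B` of a
contributing partition weighs `(Σ_B y) q_z(B)`, which vanishes for even `B` and is the flat `(Σ_B z) κ_c(B)` for odd `B` — the same for `a` and
`aᵀ` by `treeDet_transpose_of_odd`. [cite: Chaiken1982, §2] [cite: HeathBrown1994SelmerCongruentII, Appendix (Monsky), typescript p. 39 L27–L41] -/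
theorem det_bigN_transpose_zero_root_of_odd (a : V → V → ZMod 2) (y z : V → ZMod 2) {T : Finset V}
    (hrec : ∀ i ∈ T, ∀ j ∈ T, i ≠ j → a i j + a j i = y i * y j) :
    (bigN (fun i j => a j i) T y z 0).det = (bigN a T y z 0).det := by
  have hrecT : ∀ i ∈ T, ∀ j ∈ T, i ≠ j → (fun i j => a j i) i j + (fun i j => a j i) j i = y i * y j := by
    intro i hi j hj hij
    rw [add_comm]
    exact hrec i hi j hj hij
  rw [det_bigN_eq_setExp, det_bigN_eq_setExp]
  refine setExp_congr fun B hB _ => ?_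
  rw [fwt_zero_root_apply, fwt_zero_root_apply]
  by_cases hyB : ∑ i ∈ B, y i = 1
  · obtain ⟨c, hc⟩ := nonempty_of_sum_eq_one hyB
    rw [qwt_eq_sum_mul_treeDet_of_odd _ y z (hrec_mono hB hrecT) hyB hc,
      qwt_eq_sum_mul_treeDet_of_odd a y z (hrec_mono hB hrec) hyB hc,
      treeDet_transpose_of_odd a y (hrec_mono hB hrec) hyB hc]
  · have h0 : ∑ i ∈ B, y i = 0 := by
      have h01 : ∀ u : ZMod 2, u ≠ 1 → u = 0 := by decide
      exact h01 _ hyB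
    rw [h0, zero_mul, zero_mul]

/-! ## §2b. Even blocks: `det bigN a T y z 0 = det bigN a T z z z` -/

/-- **`det bigN a T y z 0 = det bigN a T z z z` on an even block** (`Σ_T y = 0`, reciprocity).  Root absorption:
`setExp(fwt a y z 0) = setExp(fwt a y z z) ⋆ setExp(q_z)` (`(Σy)q_z = (1+Σy)q_z + q_z`); marks into roots on each factor
`det bigN a R y z z = (1 + Σ_R y) det bigN a R z z 0`; the unpointed part re-assembles to `setExp(fwt a z z 0 + q_z) = setExp(fwt a z z z)`,
and the part pointed by `Σ_R y = Σ_E y` (pointing `setExp(q_z)(E)` by `y`) has an odd pointed block facing an odd nonempty co-block, whose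
symmetric form vanishes (parity). [cite: Chaiken1982, §2] [cite: Stanley1999EC2, Cor. 5.1.6] [cite: Smith2016CongruentDensity, §2.2] -/
theorem det_bigN_zero_root_eq_self_of_even (a : V → V → ZMod 2) (y z : V → ZMod 2) {T : Finset V}
    (hrec : ∀ i ∈ T, ∀ j ∈ T, i ≠ j → a i j + a j i = y i * y j) (hyT : ∑ i ∈ T, y i = 0) :
    (bigN a T y z 0).det = (bigN a T z z z).det := by
  classical
  -- `fwt a y z 0 = fwt a y z z + q_z` (characteristic two), so root absorption splits off `setExp(q_z)`
  have hsplit : fwt a y z 0 = fwt a y z (fun i => z i + z i) := by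
    rw [fwt_add_root]
    funext B
    rw [Pi.add_apply, fwt_zero_root_apply, fwt]
    have e : ∀ u v : ZMod 2, u * v = u * v + v + v := by decide
    exact e _ _
  rw [det_bigN_eq_setExp, hsplit, setExp_fwt_add_root]
  -- marks into roots on every co-factor, and `1 + Σ_{T∖E} y = 1 + Σ_E y`
  have hmark : ∀ E ∈ T.powerset, setExp (qwt a z) E * setExp (fwt a y z z) (T \ E) =
      setExp (qwt a z) E * setExp (fwt a z z 0) (T \ E) + (∑ i ∈ E, y i) * setExp (qwt a z) E * setExp (fwt a z z 0) (T \ E) := by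
    intro E hE
    rw [mem_powerset] at hE
    have hsum : ∑ i ∈ T, y i = ∑ i ∈ E, y i + ∑ i ∈ T \ E, y i := by
      rw [← sum_union disjoint_sdiff, union_sdiff_of_subset hE]
    rw [hyT] at hsum
    have hR : 1 + ∑ i ∈ T \ E, y i = 1 + ∑ i ∈ E, y i := by
      have e : ∀ u v : ZMod 2, 0 = u + v → 1 + v = 1 + u := by decide
      exact e _ _ hsum
    rw [← det_bigN_eq_setExp, det_bigN_mark_eq a y z (hrec_mono sdiff_subset hrec), hR, det_bigN_eq_setExp]
    ring
  rw [sum_congr rfl hmark, sum_add_distrib, ← setExp_add, ← fwt_add_root]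
  have hzz : fwt a z z (fun i => (0 : V → ZMod 2) i + z i) = fwt a z z z := fwt_zero_add_root a z z
  rw [hzz, ← det_bigN_eq_setExp]
  -- the pointed part vanishes
  suffices h0 : ∑ E ∈ T.powerset, (∑ i ∈ E, y i) * setExp (qwt a z) E * setExp (fwt a z z 0) (T \ E) = 0 by
    rw [h0, add_zero]
  -- point `setExp(q_z)(E)` by `y`: `(Σ_E y) setExp(q_z)(E) = Σ_{B ⊆ E} (Σ_B y) q_z(B) setExp(q_z)(E∖B)`
  have hpt : ∀ E ∈ T.powerset, (∑ i ∈ E, y i) * setExp (qwt a z) E * setExp (fwt a z z 0) (T \ E) =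
      ∑ B ∈ E.powerset, (∑ i ∈ B, y i) * qwt a z B * setExp (qwt a z) (E \ B) * setExp (fwt a z z 0) (T \ E) := by
    intro E _
    rw [← setExp_point y (qwt a z) E, sum_mul]
    exact sum_congr rfl fun B _ => by ring
  rw [sum_congr rfl hpt, sum_powerset_sum_powerset_sub]
  refine sum_eq_zero fun B hB => ?_
  rw [mem_powerset] at hB
  -- re-assemble the complement: `Σ_C setExp(q_z)(C) setExp(fwt a z z 0)((T∖B)∖C) = det bigN a (T∖B) z z z`
  have hC : ∀ C ∈ (T \ B).powerset,
      (∑ i ∈ B, y i) * qwt a z B * setExp (qwt a z) ((B ∪ C) \ B) * setExp (fwt a z z 0) (T \ (B ∪ C)) =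
        (∑ i ∈ B, y i) * qwt a z B * (setExp (qwt a z) C * setExp (fwt a z z 0) ((T \ B) \ C)) := by
    intro C hC
    rw [mem_powerset] at hC
    obtain ⟨h1, h2⟩ := union_sdiff_bookkeeping hC
    rw [h1, h2, mul_assoc]
  rw [sum_congr rfl hC, ← mul_sum, ← setExp_fwt_add_root, fwt_zero_add_root, ← det_bigN_eq_setExp]
  by_cases hyB : ∑ i ∈ B, y i = 1
  · -- odd pointed block: the co-block is odd, and nonempty unless `B = T` (impossible: `T` is even)
    have hsum : ∑ i ∈ T, y i = ∑ i ∈ B, y i + ∑ i ∈ T \ B, y i := by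
      rw [← sum_union disjoint_sdiff, union_sdiff_of_subset hB]
    rw [hyT, hyB] at hsum
    have hR : ∑ i ∈ T \ B, y i = 1 := by
      have e : ∀ u : ZMod 2, 0 = 1 + u → u = 1 := by decide
      exact e _ hsum
    rw [det_bigN_self_eq_zero a y z (T \ B) (hrec_mono sdiff_subset hrec) (nonempty_of_sum_eq_one hR) (Or.inl hR), mul_zero]
  · have h0 : ∑ i ∈ B, y i = 0 := by
      have h01 : ∀ u : ZMod 2, u ≠ 1 → u = 0 := by decide
      exact h01 _ hyB
    rw [h0, zero_mul, zero_mul]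

section MonskyEven

open Literature.NumberTheory.EllipticCurves.HeathBrown1994 Literature.NumberTheory.EllipticCurves.MonskySelmerParity
open Summit.BirchSwinnertonDyer.PrintCf2.QForm

variable {k : ℕ} (p : Fin k → ℕ) (hp : ∀ i, (p i).Prime) (hp2 : ∀ i, p i ≠ 2) (hinj : Function.Injective p)

/-! ## §2c. The uniform dictionary: `coblockWeight p S = det bigN a Sᶜ y z 0` for every `S` -/

include hp hp2 hinj in
/-- **`det M_{d_{Sᶜ}} = det bigN a Sᶜ y z 0` FOR EVERY CO-BLOCK** (`a` = UNtransposed additive Legendre weights, `y = ((−1/pᵢ)₊)`,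
`z = ((2/pᵢ)₊)`, no root weights; both parities of the co-block): odd co-block — the tree's `coblockWeight_eq_det_bigN_zero` (transposed
weights) and §2a; even co-block — the tree's `det_bigN_self_eq_coblockWeight` (`det bigN a Sᶜ z z z`) and §2b.  In forest terms:
`det M_{d_T} = Σ_{π ⊢ T, all blocks odd} ∏_B (Σ_B z) κ(B)` for every sub-tuple. [cite: HeathBrown1994SelmerCongruentII, Appendix (Monsky), typescript p. 39 L27–L33] [cite: Chaiken1982, §2] -/
theorem coblockWeight_eq_det_bigN_zero_root (S : Finset (Fin k)) :
    coblockWeight p S =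
      (bigN (fun i j => legendreMatrix p i j) Sᶜ (fun i => addLegendreSym (-1) (p i)) (fun i => addLegendreSym 2 (p i)) 0).det := by
  have hrec := hrec_mono (subset_univ Sᶜ) (hrec_legendre p hp hp2 hinj)
  by_cases hy : ∑ i ∈ Sᶜ, addLegendreSym (-1) (p i) = 1
  · rw [coblockWeight_eq_det_bigN_zero p hp hp2 hinj S hy, det_bigN_transpose_zero_root_of_odd _ _ _ hrec]
  · have hy0 : ∑ i ∈ Sᶜ, addLegendreSym (-1) (p i) = 0 := by
      have h01 : ∀ u : ZMod 2, u ≠ 1 → u = 0 := by decide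
      exact h01 _ hy
    rw [det_bigN_zero_root_eq_self_of_even _ _ _ hrec hy0, det_bigN_self_eq_coblockWeight p hp hp2 hinj Sᶜ hy0, compl_compl]

/-! ## §3. (★)₆′ for Monsky's even matrix -/

/-- **The column swap, mark copy**: `adj(M_even)_{(inr j)(inl j)} = adj(B)_{(inl j)(inl j)}` for `B = bigN a univ y z z = M_even · Sw`
(`adj B = Sw · adj M`). [cite: HeathBrown1994SelmerCongruentII, Appendix (Monsky), typescript p. 41 L20–L36] [cite: HornJohnson2013, §0.8.2] -/
theorem adjugate_monskyMatrixEven_inr_inl (j : Fin k) :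
    (monskyMatrixEven p).adjugate (Sum.inr j) (Sum.inl j) =
      (bigN (fun i j => legendreMatrix p i j) univ (fun i => addLegendreSym (-1) (p i)) (fun i => addLegendreSym 2 (p i))
        (fun i => addLegendreSym 2 (p i))).adjugate (Sum.inl j) (Sum.inl j) := by
  rw [← monskyMatrixEven_mul_swap p, adjugate_mul_distrib, adjugate_fromBlocks_swap, Matrix.mul_apply, Fintype.sum_sum_type]
  simp only [fromBlocks_apply₁₁, fromBlocks_apply₁₂, Matrix.zero_apply, zero_mul, sum_const_zero, zero_add, Matrix.one_apply,
    ite_mul, one_mul]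
  rw [Finset.sum_ite_eq univ j, if_pos (mem_univ j)]

include hp hp2 hinj in
/-- **(★)₆′ FOR MONSKY'S EVEN MATRIX** (pointed-powerset form): for distinct odd primes and every `j`,
`adj(M_even)_{(inr j)(inl j)} = Σ_{S₀ ⊆ univ∖j} det(lap a S z) · coblockWeight p S`, `S = {j} ∪ S₀` — ALL blocks `S ∋ j`, no parity factor
(`lap a S z = A_S + D₂(S)` padded by the identity; `coblockWeight p S = det M_{d_{Sᶜ}}`, Monsky's odd matrix of the co-block).  LEAD g13's
dual identity (★)₆′ (workfile `Lines/offtyz_v7_RegimeFreeLaw.md` §8.7, verified there on 12368 instances); proof = §1 + §2c.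
[cite: HeathBrown1994SelmerCongruentII, Appendix (Monsky), typescript p. 39 L10 – p. 41 L36] [cite: Chaiken1982, §2] -/
theorem adjugate_monskyMatrixEven_inr_inl_eq_sum (j : Fin k) :
    (monskyMatrixEven p).adjugate (Sum.inr j) (Sum.inl j) =
      ∑ S₀ ∈ (univ.erase j).powerset,
        (lap (fun i j => legendreMatrix p i j) (insert j S₀) (fun i => addLegendreSym 2 (p i))).det * coblockWeight p (insert j S₀) := by
  classical
  rw [adjugate_monskyMatrixEven_inr_inl, adjugate_bigN_mark_inl_inl_eq_sum_dual _ _ _ (mem_univ j)]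
  refine sum_congr rfl fun S₀ _ => ?_
  rw [coblockWeight_eq_det_bigN_zero_root p hp hp2 hinj, erase_sdiff_eq_sdiff_insert, ← compl_eq_univ_sdiff]

include hp hp2 hinj in
/-- **(★)₆′, filter form**: `adj(M_even)_{(inr j)(inl j)} = Σ_{S ⊆ univ, j ∈ S} det(lap a S z) · coblockWeight p S`.
[cite: HeathBrown1994SelmerCongruentII, Appendix (Monsky), typescript p. 39 L10 – p. 41 L36] [cite: Chaiken1982, §2] -/
theorem adjugate_monskyMatrixEven_inr_inl_eq_sum_filter (j : Fin k) :
    (monskyMatrixEven p).adjugate (Sum.inr j) (Sum.inl j) =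
      ∑ S ∈ (univ : Finset (Fin k)).powerset.filter (fun S => j ∈ S),
        (lap (fun i j => legendreMatrix p i j) S (fun i => addLegendreSym 2 (p i))).det * coblockWeight p S := by
  rw [adjugate_monskyMatrixEven_inr_inl_eq_sum p hp hp2 hinj j,
    sum_powerset_filter_mem_eq (fun S => (lap (fun i j => legendreMatrix p i j) S (fun i => addLegendreSym 2 (p i))).det *
      coblockWeight p S) (mem_univ j)]

/-- **Census coordinates of the block determinant**: `det(lap a S z) = det(A_S + D₂(S))` with `A_S = blockLegendreMatrix p S` (diagonal
recomputed inside the block) and `D₂(S) = legendreDiagonal (blockPrimes p S) 2` on `Fin #S` (increasing re-indexing `S.orderIsoOfFin`) — the form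
`det(A_S + D₂(S))` of LEAD g13's statement and of `EvenOmegaDefs`. [cite: HeathBrown1994SelmerCongruentII, Appendix (Monsky), typescript p. 39 L10–L26]
[cite: ChebotarevAgaev2002, §3 Thm. 2] -/
theorem det_lap_eq_det_block_two (S : Finset (Fin k)) :
    (lap (fun i j => legendreMatrix p i j) S (fun i => addLegendreSym 2 (p i))).det =
      (blockLegendreMatrix p S + legendreDiagonal (blockPrimes p S) 2).det := by
  set e := (S.orderIsoOfFin rfl).toEquiv with he
  rw [det_lap_eq_det_lap_reindex _ (subset_refl S) _ e]
  have hfilter : (univ : Finset (Fin S.card)).filter (fun i => (e i : Fin k) ∈ S) = univ := by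
    refine filter_true_of_mem fun i _ => (e i).2
  rw [hfilter]
  congr 1
  ext x y
  rw [lap_apply, Matrix.add_apply, blockLegendreMatrix, legendreDiagonal, diagonal_apply]
  simp only [mem_univ, and_self, if_true]
  have hq : ∀ x, blockPrimes p S x = p (e x : Fin k) := fun x => rfl
  by_cases hxy : x = y
  · subst hxy
    rw [if_pos rfl, if_pos rfl, Families.legendreMatrix_apply_self, hq, add_comm]
    congr 1
    refine sum_congr rfl fun y hy => ?_
    rw [Families.legendreMatrix_apply_of_ne p (fun h => (ne_of_mem_erase hy).symm (e.injective (Subtype.ext h))),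
      Families.legendreMatrix_apply_of_ne (blockPrimes p S) (ne_of_mem_erase hy).symm, hq, hq]
  · rw [if_neg hxy, if_neg hxy, add_zero,
      Families.legendreMatrix_apply_of_ne p (fun h => hxy (e.injective (Subtype.ext h))),
      Families.legendreMatrix_apply_of_ne (blockPrimes p S) hxy, hq, hq]

include hp hp2 hinj in
/-- **(★)₆′ in census coordinates**: `adj(M_even)_{(inr j)(inl j)} = Σ_{S ∋ j} det(A_S + D₂(S)) · det M_{d_{Sᶜ}}` with the block determinant on
`Fin #S` and `det M_{d_{Sᶜ}} = det (monskyMatrixOdd (blockPrimes p Sᶜ))` — verbatim LEAD g13's (★)₆′.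
[cite: HeathBrown1994SelmerCongruentII, Appendix (Monsky), typescript p. 39 L10 – p. 41 L36] [cite: Chaiken1982, §2] -/
theorem adjugate_monskyMatrixEven_inr_inl_eq_sum_block (j : Fin k) :
    (monskyMatrixEven p).adjugate (Sum.inr j) (Sum.inl j) =
      ∑ S ∈ (univ : Finset (Fin k)).powerset.filter (fun S => j ∈ S),
        (blockLegendreMatrix p S + legendreDiagonal (blockPrimes p S) 2).det * (monskyMatrixOdd (blockPrimes p Sᶜ)).det := by
  rw [adjugate_monskyMatrixEven_inr_inl_eq_sum_filter p hp hp2 hinj j]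
  exact sum_congr rfl fun S _ => by rw [det_lap_eq_det_block_two]; rfl

end MonskyEven

end Summit.BirchSwinnertonDyer.PrintCf2.QFormForest
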